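import Literature.MathematicalPhysics.QuantumFieldTheory.Balaban1983to89.B6Ineq2142KLevelV1

/-!
# `Balaban1983to89.B9BetaRangeKLevelV1` — the RANGE of the carrier-block map `β : (index bonds of [4] (2.3)) → 𝔅` of the N06 reading:
# inner-corner blocks of `Λ_j` are the carrier block of NO index bond; `β` is onto `𝔅` iff the family has no inner corner

T. Bałaban, *Propagators and renormalization transformations for lattice gauge theories. II*, Commun. Math. Phys. **96** (1984) 223–250
[`Balaban1984PropagatorsII`, "[4]"]; T. Bałaban, *Propagators for lattice gauge theories in a background field*, Commun. Math. Phys. **99**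
(1985) 389–434 [`Balaban1985BackgroundPropagators`, "B9"].

statement-level skeleton of published theorems with citation tags; proofs where landed; nothing here is a claim about the
Yang–Mills mass gap

THE PRINTED LOCUS.  [4] p. 224 (2.3): *"Λ_j = Ω_j^{(j)} ∖ Ω_{j+1}^{(j)} … we denote by Ω also the set of bonds ⋃_{x∈Ω} st(x)"* — the index set of
the bond constraints is `st_j(Ω_j^{(j)}) ∖ st_j(Ω_{j+1}^{(j)})` (the tree: `B6SectADomainsV1.Domains.LamBond`: at least one end-point in `Ω_j^{(j)}`,
no end-point deep); p. 231 (2.45): `𝔅 = ⋃_j Λ_j` (blocks); p. 248: *"We consider these operators on the L²-space defined by (2.69) with sites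
replaced by bonds"*.  In the cell's N06 geometry (`Node00.CarriersB6K.kGeoU`, `B9GeoNormsKLevelV1.geo9K`) the coarse "sites" ARE the index bonds
and every block-indexed statement of [B9] (Thm 3.2 (3.48), (3.49), (3.187)) is READ AT THE CARRIER BLOCKS `β c` (`B6Ineq2142KLevelV1.β`: the
block `B^j(base c)` of the base end-point — the source if it lies in `Ω_j^{(j)}`, else the target).

WHAT THIS FILE CERTIFIES (kernel-checked, sorry-free; every V1 torus `hN`, every torus family `D : TDomains`, `k ≥ 1` where needed):
* §1 `base_ne_of_corner` — a `j`-block `y` all of whose forward neighbours `y + e_μ` are deep (inside `Ω_{j+1}`) and all of whose backward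
  neighbours `y − e_μ` lie in `Ω_j^{(j)}` is the base end-point of NO index bond of level `j` (the bonds `⟨y, y+e_μ⟩` have a deep end-point, the
  bonds `⟨y−e_μ, y⟩` are based at their source); conversely `base_eq_of_forward` (a non-deep forward neighbour: `⟨y, y+e_μ⟩` is based at `y`) and
  `base_eq_of_backward` (a backward neighbour outside `Ω_j^{(j)}`: `⟨y−e_μ, y⟩` is based at `y`).
* §2 `iterBlockOf_lev_mem` ∕ `not_deep_iterBlockOf_lev` (the `𝔅`-block through a fine site is a `Λ_j`-block, `j = lev x`);
  ★ `beta_ne_blkOf_of_corner` — an INNER-CORNER block is `β c` for no index bond `c`; `exists_beta_eq_blkOf_of_forward ∕ _of_backward`;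
  ★ `exists_beta_eq_blkOf_iff` — the `𝔅`-block through `x` is a carrier block iff `y^j(x)` has a non-deep forward neighbour or a backward
  neighbour outside `Ω_j^{(j)}`; ★ `surjective_beta_iff` — `β` is onto `𝔅` iff that holds at every fine site; `not_surjective_beta_of_corner`.

WHY (cell `pub-ymgap`, N06 row 25, dag-n06-i g4 LOCATED-1): at def-Y's instance the (3.48) letter `C = (Q′G′²Q′*)⁻¹` is read as
`Node00.siteKernelOfOp … 𝔏.C (β ·) (β ·)`, so at a family with an inner corner (any `Ω_{j+1}`, `j < k`, that is an L-shaped or holed union of big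
blocks) the entries `C(y, ·)` at the corner block are read by NO entry of `(ops x).Cinv`, and the (3.25) dictionary behind (3.49)
(`B9Ineq349Whole.Dict349`, a domination by index-bond sums of `|Cinv.ker|`) cannot be DERIVED there; `surjective_beta_iff` is the exact
member-level side condition under which the carrier-block reading sees all of `𝔅`.

HONEST SCOPE.  Pure combinatorics of [4]'s index sets on the cell's torus chart; nothing of [B9]'s analysis is touched; whether a given
member HAS an inner corner is not decided here (the `TDomains` axioms (2.1)–(2.2) allow both).  Bookkeeping — NOT a node discharge, NOT
summit progress; one finite lattice programme; nothing continuum, nothing about the mass gap.  Cell `pub-ymgap` (HUMAN RULING D-0062),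
Track A node N06 [B9], N06-ASSIGNMENT v1 row 25 (bundle F4), seat `pub-ymgap-dag-n06-i` gen 4, 2026-08-27.
-/

noncomputable section

namespace Literature.MathematicalPhysics.QuantumFieldTheory.Balaban1983to89.B9BetaRangeKLevelV1

open LatticeFieldCalculus
open B5Eq118OneStroke (iterBlockOf iterBlockOf_succ)
open B6MultiLevelBoxOperator (N0)
open B6MultiLevelTorusOperator (TDomains)
open B6Geom246MultiLevelBox (bset blkOf blkOf_val exists_blkOf_eq)
open B6GlobalChartV1 (PV toBox domT iterBlockOf_mem_domT_iff)
open B6ScalarChartV1 (blkOf_toBox_eq_iff)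
open B6SectAOperatorsV1 (BondIdx)
open B6Ineq2142KLevelV1 (lvl base baseSite β lev_eq_of_base iterBlockOf_baseSite beta_level)

variable {d ℓ : ℕ} {m K : ℕ} {hd : 1 ≤ d + 1} {hL : Odd (ℓ + 1) ∧ 1 < ℓ + 1}
variable {Mh k R : ℕ} {P' : Fin (d + 1) → ℕ}

/-- `(y − e_μ) + e_μ = y`. [folklore] -/
private theorem shift_unshift {P : Params} {j : ℕ} (y : Site P j) (μ : Fin P.d) : (y.unshift μ).shift μ = y := by
  funext ν
  by_cases h : ν = μ
  · subst h; simp [Site.shift, Site.unshift]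
  · simp [Site.shift, Site.unshift, Function.update_of_ne h]

/-- `(y + e_μ) − e_μ = y`. [folklore] -/
private theorem unshift_shift {P : Params} {j : ℕ} (y : Site P j) (μ : Fin P.d) : (y.shift μ).unshift μ = y := by
  funext ν
  by_cases h : ν = μ
  · subst h; simp [Site.shift, Site.unshift]
  · simp [Site.shift, Site.unshift, Function.update_of_ne h]

section Base

variable (hN : ∀ μ, N0 ℓ Mh k P' μ = (PV d ℓ m K hd hL).sitesPerDir 0) (D : TDomains d ℓ Mh k P' R) (hk : k ≤ m + K)

/-- **AN INNER-CORNER BLOCK OF `Λ_j` IS THE BASE END-POINT OF NO INDEX BOND OF LEVEL `j`**: if every forward neighbour `y + e_μ` of the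
`j`-block `y` lies inside `Ω_{j+1}` (is deep) and every backward neighbour `y − e_μ` lies in `Ω_j^{(j)}`, then no bond of print's index set
`Λ_j = st_j(Ω_j^{(j)}) ∖ st_j(Ω_{j+1}^{(j)})` ((2.3): at least one end-point in `Ω_j^{(j)}`, no end-point deep) has base end-point `y`
(the bonds `⟨y, y + e_μ⟩` have a deep end-point; the bonds `⟨y − e_μ, y⟩` are based at their source).
[cite: Balaban1984PropagatorsII, (2.3) p.224 («Λ_j also the set of bonds …»), (2.45) p.231 (𝔅 = ⋃_j Λ_j)] -/
theorem base_ne_of_corner {j : ℕ} (hjlt : j < k + 1) (y : Site (PV d ℓ m K hd hL) j)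
    (hfwd : ∀ μ, (domT hN D hk).Deep j (y.shift μ)) (hbwd : ∀ μ, y.unshift μ ∈ (domT hN D hk).Om j)
    (b : PBond (PV d ℓ m K hd hL) j) (hb : (domT hN D hk).LamBond j b) :
    base hN D hk ⟨⟨⟨j, hjlt⟩, b⟩, hb⟩ ≠ y := by
  intro h
  unfold base at h
  simp only [lvl] at h
  split_ifs at h with hs
  · -- base = source = y: the target y + e_μ is deep
    have ht : (domT hN D hk).Deep j b.tgt := by
      rw [show b.tgt = y.shift b.dir by rw [PBond.tgt, h]]
      exact hfwd b.dir
    exact hb.2.2 ht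
  · -- base = target = y: the source y − e_μ lies in Ω_j^{(j)}, contradiction
    have hsrc : b.src = y.unshift b.dir := by
      have h' : b.src.shift b.dir = y := h
      rw [← h', unshift_shift]
    exact hs (by rw [hsrc]; exact hbwd b.dir)

/-- conversely, a `Λ_j`-block with a NON-DEEP FORWARD NEIGHBOUR is the base of the bond `⟨y, y + e_μ⟩`. [cite: Balaban1984PropagatorsII, (2.3) p.224] -/
theorem base_eq_of_forward {j : ℕ} (hjlt : j < k + 1) (y : Site (PV d ℓ m K hd hL) j) (hy : y ∈ (domT hN D hk).Om j)
    (hyd : ¬ (domT hN D hk).Deep j y) (μ : Fin (d + 1)) (hμ : ¬ (domT hN D hk).Deep j (y.shift μ)) :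
    base hN D hk ⟨⟨⟨j, hjlt⟩, ⟨y, μ⟩⟩, ⟨Or.inl hy, hyd, hμ⟩⟩ = y := by
  unfold base
  simp [lvl, hy]

/-- conversely, a `Λ_j`-block with a BACKWARD NEIGHBOUR OUTSIDE `Ω_j^{(j)}` is the base of the bond `⟨y − e_μ, y⟩`. [cite: Balaban1984PropagatorsII, (2.3) p.224] -/
theorem base_eq_of_backward {j : ℕ} (hjlt : j < k + 1) (y : Site (PV d ℓ m K hd hL) j) (hy : y ∈ (domT hN D hk).Om j)
    (hyd : ¬ (domT hN D hk).Deep j y) (μ : Fin (d + 1)) (hμ : y.unshift μ ∉ (domT hN D hk).Om j) :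
    ∃ hb : (domT hN D hk).LamBond j ⟨y.unshift μ, μ⟩, base hN D hk ⟨⟨⟨j, hjlt⟩, ⟨y.unshift μ, μ⟩⟩, hb⟩ = y := by
  have htgt : (⟨y.unshift μ, μ⟩ : PBond (PV d ℓ m K hd hL) j).tgt = y := shift_unshift y μ
  have hnd : ¬ (domT hN D hk).Deep j (y.unshift μ) := fun hdp => hμ ((domT hN D hk).nested _ hdp)
  refine ⟨⟨Or.inr (by rw [htgt]; exact hy), hnd, by rw [htgt]; exact hyd⟩, ?_⟩
  unfold base
  simp only [lvl]
  rw [if_neg (show ¬ (y.unshift μ) ∈ (domT hN D hk).Om j from hμ)]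
  exact htgt

end Base

/-! ## §2 The range of the carrier-block map `β : (index bonds) → 𝔅` -/

section Range

variable (hN : ∀ μ, N0 ℓ Mh k P' μ = (PV d ℓ m K hd hL).sitesPerDir 0) (D : TDomains d ℓ Mh k P' R) (hk : k ≤ m + K)

/-- the `j`-block point of a fine site at its own level `j = lev x` lies in `Ω_j^{(j)}`. [cite: Balaban1984PropagatorsII, (2.3)–(2.4) p.224] -/
theorem iterBlockOf_lev_mem (x : Site (PV d ℓ m K hd hL) 0) :
    iterBlockOf (D.lev (toBox hN x : Fin (d + 1) → ℤ)) x ∈ (domT hN D hk).Om (D.lev (toBox hN x : Fin (d + 1) → ℤ)) :=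
  (iterBlockOf_mem_domT_iff hN D hk (D.one_le_lev _) (D.lev_le _) x).2 le_rfl

/-- … and is not deep (`x ∈ B^j(Λ_j)` for `j = lev x`). [cite: Balaban1984PropagatorsII, (2.3)–(2.4) p.224] -/
theorem not_deep_iterBlockOf_lev (x : Site (PV d ℓ m K hd hL) 0) :
    ¬ (domT hN D hk).Deep (D.lev (toBox hN x : Fin (d + 1) → ℤ)) (iterBlockOf (D.lev (toBox hN x : Fin (d + 1) → ℤ)) x) := by
  by_cases hjk : D.lev (toBox hN x : Fin (d + 1) → ℤ) + 1 ≤ k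
  · intro hdp
    have h := (iterBlockOf_mem_domT_iff hN D hk (by omega) hjk x).1
    rw [iterBlockOf_succ] at h
    have := h hdp
    omega
  · exact (domT hN D hk).not_deep_of_le (show (domT hN D hk).k ≤ _ from by change k ≤ _; omega) _

/-- ★ **AN INNER-CORNER BLOCK IS THE CARRIER BLOCK OF NO INDEX BOND**: if the `𝔅`-block `B^j(y)` through the fine site `x` (`j = lev x`,
`y = y^j(x)`) has all its forward neighbours `y + e_μ` inside `Ω_{j+1}` and all its backward neighbours `y − e_μ` in `Ω_j^{(j)}`, then
`β c ≠ B^j(y)` for EVERY index bond `c` — the carrier-block map `β` of the «sites replaced by bonds» reading is NOT onto `𝔅` at such families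
(so a block-indexed statement read at the carrier blocks of the index bonds is silent about `B^j(y)`).
[cite: Balaban1984PropagatorsII, (2.3) p.224 + (2.45) p.231 (index bonds vs. blocks); p.248 («sites replaced by bonds»)] -/
theorem beta_ne_blkOf_of_corner (hk1 : 1 ≤ k) (x : Site (PV d ℓ m K hd hL) 0)
    (hfwd : ∀ μ, (domT hN D hk).Deep (D.lev (toBox hN x : Fin (d + 1) → ℤ))
      ((iterBlockOf (D.lev (toBox hN x : Fin (d + 1) → ℤ)) x).shift μ))
    (hbwd : ∀ μ, (iterBlockOf (D.lev (toBox hN x : Fin (d + 1) → ℤ)) x).unshift μ ∈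
      (domT hN D hk).Om (D.lev (toBox hN x : Fin (d + 1) → ℤ)))
    (c : BondIdx (domT hN D hk)) : β hN D hk c ≠ blkOf D.toDomains (toBox hN x) := by
  intro h
  have h' : blkOf D.toDomains (toBox hN (baseSite hN D hk c)) = blkOf D.toDomains (toBox hN x) := h
  have hlev : D.lev (toBox hN (baseSite hN D hk c) : Fin (d + 1) → ℤ) = lvl hN D hk c :=
    lev_eq_of_base hN D hk hk1 c (iterBlockOf_baseSite hN D hk c)
  have hl : lvl hN D hk c = D.lev (toBox hN x : Fin (d + 1) → ℤ) := by
    have := congrArg (fun s : ↥(bset D.toDomains) => s.1.1) h'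
    simp only [blkOf_val] at this
    rw [← hlev]; exact this
  have hblk := (blkOf_toBox_eq_iff hN D hk x (baseSite hN D hk c)).1 h'
  -- `hblk : iterBlockOf (lev x) (baseSite c) = iterBlockOf (lev x) x`; destructure the bond and align its level with `lev x`
  obtain ⟨⟨⟨j, hjlt⟩, b⟩, hb⟩ := c
  change j = D.lev (toBox hN x : Fin (d + 1) → ℤ) at hl
  subst hl
  have hbase : base hN D hk ⟨⟨⟨_, hjlt⟩, b⟩, hb⟩ = iterBlockOf (D.lev (toBox hN x : Fin (d + 1) → ℤ)) x :=
    (iterBlockOf_baseSite hN D hk ⟨⟨⟨_, hjlt⟩, b⟩, hb⟩).symm.trans hblk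
  exact base_ne_of_corner hN D hk hjlt _ hfwd hbwd b hb hbase

/-- a `𝔅`-block with a NON-DEEP FORWARD NEIGHBOUR is a carrier block (of `⟨y, y + e_μ⟩`). [cite: Balaban1984PropagatorsII, (2.3) p.224 + (2.45) p.231] -/
theorem exists_beta_eq_blkOf_of_forward (x : Site (PV d ℓ m K hd hL) 0) (μ : Fin (d + 1))
    (hμ : ¬ (domT hN D hk).Deep (D.lev (toBox hN x : Fin (d + 1) → ℤ))
      ((iterBlockOf (D.lev (toBox hN x : Fin (d + 1) → ℤ)) x).shift μ)) :
    ∃ c : BondIdx (domT hN D hk), β hN D hk c = blkOf D.toDomains (toBox hN x) := by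
  have hjlt : D.lev (toBox hN x : Fin (d + 1) → ℤ) < (domT hN D hk).k + 1 := Nat.lt_succ_of_le (D.lev_le _)
  refine ⟨⟨⟨⟨_, hjlt⟩, ⟨iterBlockOf (D.lev (toBox hN x : Fin (d + 1) → ℤ)) x, μ⟩⟩,
    ⟨Or.inl (iterBlockOf_lev_mem hN D hk x), not_deep_iterBlockOf_lev hN D hk x, hμ⟩⟩, ?_⟩
  show blkOf D.toDomains (toBox hN (baseSite hN D hk _)) = blkOf D.toDomains (toBox hN x)
  refine (blkOf_toBox_eq_iff hN D hk x _).2 ?_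
  exact (iterBlockOf_baseSite hN D hk _).trans
    (base_eq_of_forward hN D hk hjlt _ (iterBlockOf_lev_mem hN D hk x) (not_deep_iterBlockOf_lev hN D hk x) μ hμ)

/-- a `𝔅`-block with a BACKWARD NEIGHBOUR OUTSIDE `Ω_j^{(j)}` is a carrier block (of `⟨y − e_μ, y⟩`). [cite: Balaban1984PropagatorsII, (2.3) p.224 + (2.45) p.231] -/
theorem exists_beta_eq_blkOf_of_backward (x : Site (PV d ℓ m K hd hL) 0) (μ : Fin (d + 1))
    (hμ : (iterBlockOf (D.lev (toBox hN x : Fin (d + 1) → ℤ)) x).unshift μ ∉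
      (domT hN D hk).Om (D.lev (toBox hN x : Fin (d + 1) → ℤ))) :
    ∃ c : BondIdx (domT hN D hk), β hN D hk c = blkOf D.toDomains (toBox hN x) := by
  have hjlt : D.lev (toBox hN x : Fin (d + 1) → ℤ) < (domT hN D hk).k + 1 := Nat.lt_succ_of_le (D.lev_le _)
  obtain ⟨hb, hbase⟩ := base_eq_of_backward hN D hk hjlt _ (iterBlockOf_lev_mem hN D hk x)
    (not_deep_iterBlockOf_lev hN D hk x) μ hμ
  refine ⟨⟨⟨⟨_, hjlt⟩, ⟨(iterBlockOf (D.lev (toBox hN x : Fin (d + 1) → ℤ)) x).unshift μ, μ⟩⟩, hb⟩, ?_⟩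
  show blkOf D.toDomains (toBox hN (baseSite hN D hk _)) = blkOf D.toDomains (toBox hN x)
  refine (blkOf_toBox_eq_iff hN D hk x _).2 ?_
  exact (iterBlockOf_baseSite hN D hk _).trans hbase

/-- ★ **THE RANGE OF `β`, CHARACTERISED**: the `𝔅`-block through `x` (`j = lev x`, `y = y^j(x)`) is a carrier block of some index bond iff
`y` has a non-deep forward neighbour or a backward neighbour outside `Ω_j^{(j)}`. [cite: Balaban1984PropagatorsII, (2.3) p.224 + (2.45) p.231] -/
theorem exists_beta_eq_blkOf_iff (hk1 : 1 ≤ k) (x : Site (PV d ℓ m K hd hL) 0) :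
    (∃ c : BondIdx (domT hN D hk), β hN D hk c = blkOf D.toDomains (toBox hN x)) ↔
      (∃ μ, ¬ (domT hN D hk).Deep (D.lev (toBox hN x : Fin (d + 1) → ℤ))
          ((iterBlockOf (D.lev (toBox hN x : Fin (d + 1) → ℤ)) x).shift μ)) ∨
        (∃ μ, (iterBlockOf (D.lev (toBox hN x : Fin (d + 1) → ℤ)) x).unshift μ ∉
          (domT hN D hk).Om (D.lev (toBox hN x : Fin (d + 1) → ℤ))) := by
  constructor
  · rintro ⟨c, hc⟩
    by_contra hno
    simp only [not_or, not_exists, not_not] at hno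
    exact beta_ne_blkOf_of_corner hN D hk hk1 x hno.1 hno.2 c hc
  · rintro (⟨μ, hμ⟩ | ⟨μ, hμ⟩)
    · exact exists_beta_eq_blkOf_of_forward hN D hk x μ hμ
    · exact exists_beta_eq_blkOf_of_backward hN D hk x μ hμ

/-- ★ **`β` IS ONTO `𝔅` IFF THE FAMILY HAS NO INNER CORNER**: every `𝔅`-block has a non-deep forward neighbour or a backward neighbour outside its
`Ω_j^{(j)}` (read at any fine site of the block).  The side condition under which block-indexed statements (Thm 3.2 (3.48), (3.49) of [B9]) read at
the carrier blocks of the index bonds see all of `𝔅`. [cite: Balaban1984PropagatorsII, (2.3) p.224 + (2.45) p.231; p.248 («sites replaced by bonds»)] -/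
theorem surjective_beta_iff (hk1 : 1 ≤ k) :
    Function.Surjective (β hN D hk) ↔
      ∀ x : Site (PV d ℓ m K hd hL) 0,
        (∃ μ, ¬ (domT hN D hk).Deep (D.lev (toBox hN x : Fin (d + 1) → ℤ))
            ((iterBlockOf (D.lev (toBox hN x : Fin (d + 1) → ℤ)) x).shift μ)) ∨
          (∃ μ, (iterBlockOf (D.lev (toBox hN x : Fin (d + 1) → ℤ)) x).unshift μ ∉
            (domT hN D hk).Om (D.lev (toBox hN x : Fin (d + 1) → ℤ))) := by
  constructor
  · intro hs x
    exact (exists_beta_eq_blkOf_iff hN D hk hk1 x).1 (hs _)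
  · intro h s
    obtain ⟨z, hz⟩ := exists_blkOf_eq D.toDomains s
    obtain ⟨x, rfl⟩ := B6GlobalChartV1.toBox_surjective hN z
    obtain ⟨c, hc⟩ := (exists_beta_eq_blkOf_iff hN D hk hk1 x).2 (h x)
    exact ⟨c, hc.trans hz⟩

/-- in particular a family WITH an inner-corner block has a NON-surjective carrier-block map. [cite: Balaban1984PropagatorsII, (2.3) p.224 + (2.45) p.231] -/
theorem not_surjective_beta_of_corner (hk1 : 1 ≤ k) (x : Site (PV d ℓ m K hd hL) 0)
    (hfwd : ∀ μ, (domT hN D hk).Deep (D.lev (toBox hN x : Fin (d + 1) → ℤ))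
      ((iterBlockOf (D.lev (toBox hN x : Fin (d + 1) → ℤ)) x).shift μ))
    (hbwd : ∀ μ, (iterBlockOf (D.lev (toBox hN x : Fin (d + 1) → ℤ)) x).unshift μ ∈
      (domT hN D hk).Om (D.lev (toBox hN x : Fin (d + 1) → ℤ))) :
    ¬ Function.Surjective (β hN D hk) := fun hs => by
  obtain ⟨c, hc⟩ := hs (blkOf D.toDomains (toBox hN x))
  exact beta_ne_blkOf_of_corner hN D hk hk1 x hfwd hbwd c hc

end Range

end Literature.MathematicalPhysics.QuantumFieldTheory.Balaban1983to89.B9BetaRangeKLevelV1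

end
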